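import Mathlib
import Literature.MathematicalPhysics.QuantumFieldTheory.LatticeMirrorNormals
import Literature.MathematicalPhysics.QuantumFieldTheory.MirrorRPKernel
import Summits.CriticalPhenomena.Ising3DConformalLimit.Theorems.UnitLightConeUnitSpeedTwoPointLaplaceMeasurePowerLaw
import Summits.CriticalPhenomena.Ising3DConformalLimit.Theorems.UnitLightConeUnitSpeedTwoPointSommerfeldWeyl
import Summits.CriticalPhenomena.Ising3DConformalLimit.Theorems.UnitLightConeUnitSpeedTwoPointConePushforward

/-!
# Crux `HyperoctahedralRP.HRP2Rigidity` (stmt-CriticalPhenomena-1979) — negative-side support: the DIAGONAL mirrors are load-bearing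

THEOREM-ONLY file (no definitions).  The nine-mirror rigidity theorem (`nineMirrorRigidityBelowFour`,
`HRP2Rigidity_of`) assumes invariance and reflection positivity for the three coordinate mirrors `eᵢ` AND the six
diagonal mirrors `eᵢ ± eⱼ`.  Here we kernel-check the statement of the paper draft (HOME/nine-mirror-isotropy,
Proposition "The diagonal mirrors are necessary") that the coordinate mirrors alone do NOT suffice:

* `riesz_coneRepresentation`, `riesz_isMirrorRPKernel_single_two`, `riesz_isMirrorRPKernel_single` — the Riesz
  kernel `‖x‖^(-2Δ)` on `ℝ³` is reflection positive for every coordinate mirror as soon as `Δ ≥ 1/2` (degree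
  `-β`, `β ≥ 1`; Frank–Lieb 2010, Lemma 2.1 / Glimm–Jaffe Prop. 6.2.5 for `β = 1`).  PROOF (no new analysis): the
  tree's Källén–Lehmann machinery of crux `UnitSpeedTwoPoint` (stubs `stub_laplaceMeasurePowerLaw`,
  `stub_sommerfeldWeyl`, `stub_conePushforward`, items of route `UnitLightCone`) writes
  `(a² + b² + t²)^(-Δ) = ∫ cos(k·(a,b)) e^{-ω|t|} dμ(k,ω)` for a positive measure `μ`; each integrand is an extremal
  RP kernel (`IsMirrorRPKernel.exp_mul_cos`), and mixtures of RP kernels are RP (`IsMirrorRPKernel.integral`).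
* `anisotropic_coordinateRP_witness` — for every `Δ ≥ 1/2` the ANISOTROPIC kernel `K x = ‖x + x₂ e₂‖^(-2Δ)
  = (x₀² + x₁² + 4x₂²)^(-Δ)` (pull-back of the Riesz kernel by `A = diag(1,1,2)`, which commutes with the three
  coordinate reflections and preserves their half-spaces) is continuous and positive off `0`, homogeneous of
  degree `-2Δ`, invariant AND reflection positive for `e₀, e₁, e₂`, and NOT `O(3)`-invariant
  (`K e₀ = 1 ≠ 4^(-Δ) = K e₂`).
* `nineMirrorRigidity_false_with_coordinate_mirrors_only` — hence the rigidity statement with the six diagonal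
  mirrors dropped is FALSE at every `Δ ≥ 1/2` (in particular on the whole Ising window `[1/2, 1]`).

(O(3) writer seat, cell pub-ising3x, 2026-08-25; supports item stmt-CriticalPhenomena-1979.  The paper's version
uses `diag(1,1,√2)`; any `diag(1,1,c)`, `c ≠ 1`, works and `c = 2` keeps the arithmetic rational.)
-/

noncomputable section

open scoped BigOperators InnerProductSpace
open MeasureTheory

namespace Summit.CriticalPhenomena.Ising3DConformalLimit.Theorems.HRP2Rigidity.Negative

open Literature.MathematicalPhysics.QuantumFieldTheory
open Summit.CriticalPhenomena.Ising3DConformalLimit.Cruxes.UnitSpeedTwoPoint.YukawaSubordination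
  (stub_laplaceMeasurePowerLaw stub_sommerfeldWeyl stub_conePushforward)

/-- `‖x‖ = √(x₀² + x₁² + x₂²)` on `ℝ³`. [folklore] -/
theorem norm_eq_sqrt_coords (x : EuclideanSpace ℝ (Fin 3)) :
    ‖x‖ = Real.sqrt (x 0 ^ 2 + x 1 ^ 2 + x 2 ^ 2) := by
  have h : ‖x‖ ^ 2 = x 0 ^ 2 + x 1 ^ 2 + x 2 ^ 2 := by
    rw [EuclideanSpace.norm_eq, Real.sq_sqrt (by positivity), Fin.sum_univ_three]
    simp only [Real.norm_eq_abs, sq_abs]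
  rw [← h, Real.sqrt_sq (norm_nonneg _)]

/-- **Unit-cone Källén–Lehmann representation of the Riesz kernel** `r^(-2Δ)`, `Δ ≥ 1/2`, in the axis frame `e₂`
(mass subordination through the Yukawa family; the three landed stubs of crux `UnitSpeedTwoPoint`).
[cite: GlimmJaffeQP1987, Prop. 6.2.5] -/
theorem riesz_coneRepresentation {Δ : ℝ} (hΔ : 1 / 2 ≤ Δ) :
    ∃ μ : Measure (EuclideanSpace ℝ (Fin 2) × ℝ), μ {p : EuclideanSpace ℝ (Fin 2) × ℝ | p.2 < ‖p.1‖} = 0 ∧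
      ∀ t a b : ℝ, t ≠ 0 →
        ∫ p, Real.cos (p.1 0 * a + p.1 1 * b) * Real.exp (-(p.2 * |t|)) ∂μ =
          Real.sqrt (a ^ 2 + b ^ 2 + t ^ 2) ^ (-(2 * Δ)) := by
  obtain ⟨ν, hsf, hν0, hν⟩ := stub_laplaceMeasurePowerLaw Δ hΔ
  obtain ⟨μ, hsupp, hμ⟩ := stub_conePushforward ν hsf hν0 (fun r hr => (hν r hr).1) stub_sommerfeldWeyl
  refine ⟨μ, hsupp, fun t a b ht => ?_⟩
  have ht2 : 0 < t ^ 2 := by positivity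
  have hr : 0 < Real.sqrt (a ^ 2 + b ^ 2 + t ^ 2) := Real.sqrt_pos.2 (by positivity)
  rw [hμ t a b ht, integral_div, (hν _ hr).2, ← Real.rpow_sub_one hr.ne']
  congr 1
  ring

/-- **The Riesz kernel `‖x‖^(-2Δ)`, `Δ ≥ 1/2`, is reflection positive for the coordinate mirror `e₂`.**
[cite: FrankLieb2010, Lemma 2.1] -/
theorem riesz_isMirrorRPKernel_single_two {Δ : ℝ} (hΔ : 1 / 2 ≤ Δ) :
    IsMirrorRPKernel (EuclideanSpace.single (2 : Fin 3) (1 : ℝ))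
      (fun x : EuclideanSpace ℝ (Fin 3) => ‖x‖ ^ (-(2 * Δ))) := by
  obtain ⟨μ, -, hμ⟩ := riesz_coneRepresentation hΔ
  have hin : ∀ x : EuclideanSpace ℝ (Fin 3), ⟪x, EuclideanSpace.single (2 : Fin 3) (1 : ℝ)⟫_ℝ = x 2 :=
    fun x => by simp [EuclideanSpace.inner_single_right]
  -- the mixture of extremal RP kernels `cos(k·x_⊥) e^{-ω|x₂|}`
  have hRP : IsMirrorRPKernel (EuclideanSpace.single (2 : Fin 3) (1 : ℝ)) (fun x : EuclideanSpace ℝ (Fin 3) =>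
      ∫ p : EuclideanSpace ℝ (Fin 2) × ℝ, Real.cos (p.1 0 * x 0 + p.1 1 * x 1) * Real.exp (-(p.2 * |x 2|)) ∂μ) := by
    refine IsMirrorRPKernel.integral (Filter.Eventually.of_forall fun p => ?_) ?_
    · -- each integrand is an extremal RP kernel on the open half-space
      have hq : ⟪(EuclideanSpace.single 0 (p.1 0) + EuclideanSpace.single 1 (p.1 1) : EuclideanSpace ℝ (Fin 3)),
          EuclideanSpace.single (2 : Fin 3) (1 : ℝ)⟫_ℝ = 0 := by
        simp [inner_add_left, EuclideanSpace.inner_single_left]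
      refine (IsMirrorRPKernel.exp_mul_cos (EuclideanSpace.single (2 : Fin 3) (1 : ℝ)) _ hq p.2).congr
        fun x hx => ?_
      rw [hin] at hx
      have hxq : ⟪x, (EuclideanSpace.single 0 (p.1 0) + EuclideanSpace.single 1 (p.1 1) : EuclideanSpace ℝ (Fin 3))⟫_ℝ =
          p.1 0 * x 0 + p.1 1 * x 1 := by
        simp [inner_add_right, EuclideanSpace.inner_single_right]
      rw [hin, hxq, abs_of_pos hx, mul_comm]
    · -- integrability of the integrands, from the (finite, positive) value at `a = b = 0`
      intro x hx
      rw [hin] at hx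
      have hI : Integrable (fun p : EuclideanSpace ℝ (Fin 2) × ℝ => Real.exp (-(p.2 * |x 2|))) μ := by
        by_contra h
        have h0 := hμ (x 2) 0 0 hx.ne'
        simp only [mul_zero, add_zero, Real.cos_zero, one_mul] at h0
        rw [integral_undef h] at h0
        have hpos : 0 < Real.sqrt (0 ^ 2 + 0 ^ 2 + x 2 ^ 2) ^ (-(2 * Δ)) :=
          Real.rpow_pos_of_pos (Real.sqrt_pos.2 (by positivity)) _
        linarith
      have hc0 : Continuous fun p : EuclideanSpace ℝ (Fin 2) × ℝ => p.1 0 :=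
        (EuclideanSpace.proj (0 : Fin 2)).continuous.comp continuous_fst
      have hc1 : Continuous fun p : EuclideanSpace ℝ (Fin 2) × ℝ => p.1 1 :=
        (EuclideanSpace.proj (1 : Fin 2)).continuous.comp continuous_fst
      have hcont : Continuous fun p : EuclideanSpace ℝ (Fin 2) × ℝ =>
          Real.cos (p.1 0 * x 0 + p.1 1 * x 1) * Real.exp (-(p.2 * |x 2|)) :=
        (Real.continuous_cos.comp ((hc0.mul continuous_const).add (hc1.mul continuous_const))).mul
          (Real.continuous_exp.comp (continuous_snd.mul continuous_const).neg)
      refine hI.mono' hcont.aestronglyMeasurable (Filter.Eventually.of_forall fun p => ?_)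
      rw [Real.norm_eq_abs, abs_mul, Real.abs_exp]
      exact mul_le_of_le_one_left (Real.exp_nonneg _) (Real.abs_cos_le_one _)
  refine hRP.congr fun x hx => ?_
  rw [hin] at hx
  show ∫ p, Real.cos (p.1 0 * x 0 + p.1 1 * x 1) * Real.exp (-(p.2 * |x 2|)) ∂μ = ‖x‖ ^ (-(2 * Δ))
  rw [hμ (x 2) (x 0) (x 1) hx.ne', norm_eq_sqrt_coords]

/-- **The Riesz kernel is reflection positive for EVERY coordinate mirror `eᵢ`** (transport of the `e₂` case by the
coordinate transposition, an isometry fixing the kernel). [cite: FrankLieb2010, Lemma 2.1] -/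
theorem riesz_isMirrorRPKernel_single {Δ : ℝ} (hΔ : 1 / 2 ≤ Δ) (i : Fin 3) :
    IsMirrorRPKernel (EuclideanSpace.single i (1 : ℝ))
      (fun x : EuclideanSpace ℝ (Fin 3) => ‖x‖ ^ (-(2 * Δ))) := by
  -- the isometry swapping the coordinates `i` and `2`
  set R : EuclideanSpace ℝ (Fin 3) ≃ₗᵢ[ℝ] EuclideanSpace ℝ (Fin 3) :=
    LinearIsometryEquiv.piLpCongrLeft 2 ℝ ℝ (Equiv.swap i 2) with hR
  have hRi : R (EuclideanSpace.single i (1 : ℝ)) = EuclideanSpace.single 2 1 := by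
    rw [hR, LinearIsometryEquiv.piLpCongrLeft_single, Equiv.swap_apply_left]
  have h2 := riesz_isMirrorRPKernel_single_two hΔ
  rw [← hRi] at h2
  have h3 := IsMirrorRPKernel.comp_linearIsometryEquiv R h2
  simpa only [LinearIsometryEquiv.norm_map] using h3

/-- **The anisotropic coordinate-RP witness.**  For `Δ ≥ 1/2` the kernel `K x = ‖x + x₂ e₂‖^(-2Δ) = (x₀² + x₁² +
4 x₂²)^(-Δ)` is continuous and positive off the origin, homogeneous of degree `-2Δ`, invariant and reflection
positive for the three coordinate mirrors, and takes different values at the unit vectors `e₀` and `e₂`. -/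
theorem anisotropic_coordinateRP_witness {Δ : ℝ} (hΔ : 1 / 2 ≤ Δ) :
    let K : EuclideanSpace ℝ (Fin 3) → ℝ :=
      fun x => ‖x + x 2 • EuclideanSpace.single (2 : Fin 3) (1 : ℝ)‖ ^ (-(2 * Δ))
    ContinuousOn K {0}ᶜ ∧ (∀ x, x ≠ 0 → 0 < K x) ∧
      (∀ c : ℝ, 0 < c → ∀ x, K (c • x) = c ^ (-(2 * Δ)) * K x) ∧
      (∀ i : Fin 3, (∀ x, K ((ℝ ∙ EuclideanSpace.single i (1 : ℝ))ᗮ.reflection x) = K x) ∧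
        IsMirrorRPKernel (EuclideanSpace.single i (1 : ℝ)) K) ∧
      K (EuclideanSpace.single 0 1) ≠ K (EuclideanSpace.single 2 1) := by
  intro K
  -- the linear map `A x = x + x₂ e₂ = diag(1,1,2) x`
  set e2 : EuclideanSpace ℝ (Fin 3) := EuclideanSpace.single (2 : Fin 3) (1 : ℝ) with he2
  have hA : ∀ (x : EuclideanSpace ℝ (Fin 3)) (l : Fin 3),
      (x + x 2 • e2) l = if l = 2 then 2 * x 2 else x l := by
    intro x l
    fin_cases l
    · simp [he2]
    · simp [he2]
    · simp [he2]; ring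
  have hA0 : ∀ x : EuclideanSpace ℝ (Fin 3), x + x 2 • e2 = 0 ↔ x = 0 := by
    intro x
    constructor
    · intro h
      ext l
      have hl := congrArg (fun v : EuclideanSpace ℝ (Fin 3) => v l) h
      simp only [PiLp.zero_apply] at hl ⊢
      rw [hA] at hl
      fin_cases l <;> simpa using hl
    · intro h; subst h; simp
  refine ⟨?_, ?_, ?_, ?_, ?_⟩
  · -- continuity off the origin
    have hlin : Continuous fun x : EuclideanSpace ℝ (Fin 3) => x + x 2 • e2 :=
      continuous_id.add (((EuclideanSpace.proj (2 : Fin 3)).continuous).smul continuous_const)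
    intro x hx
    have hx' : x + x 2 • e2 ≠ 0 := fun h => hx ((hA0 x).1 h)
    exact ((hlin.norm.continuousAt).rpow_const (Or.inl (norm_ne_zero_iff.2 hx'))).continuousWithinAt
  · -- positivity
    intro x hx
    have hx' : x + x 2 • e2 ≠ 0 := fun h => hx ((hA0 x).1 h)
    exact Real.rpow_pos_of_pos (norm_pos_iff.2 hx') _
  · -- homogeneity
    intro c hc x
    show ‖c • x + (c • x) 2 • e2‖ ^ (-(2 * Δ)) = c ^ (-(2 * Δ)) * ‖x + x 2 • e2‖ ^ (-(2 * Δ))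
    have : c • x + (c • x) 2 • e2 = c • (x + x 2 • e2) := by
      rw [smul_add, PiLp.smul_apply, smul_eq_mul, mul_smul]
    rw [this, norm_smul, Real.norm_of_nonneg hc.le, Real.mul_rpow hc.le (norm_nonneg _)]
  · -- invariance and RP for each coordinate mirror
    intro i
    have hcomm : ∀ x : EuclideanSpace ℝ (Fin 3),
        (ℝ ∙ EuclideanSpace.single i (1 : ℝ))ᗮ.reflection x + ((ℝ ∙ EuclideanSpace.single i (1 : ℝ))ᗮ.reflection x) 2 • e2 =
          (ℝ ∙ EuclideanSpace.single i (1 : ℝ))ᗮ.reflection (x + x 2 • e2) := by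
      intro x
      ext l
      rw [PiLp.add_apply, PiLp.smul_apply, reflection_single_apply, reflection_single_apply,
        reflection_single_apply, PiLp.add_apply, PiLp.smul_apply]
      fin_cases i <;> fin_cases l <;> simp [he2]
    constructor
    · intro x
      show ‖_‖ ^ (-(2 * Δ)) = ‖_‖ ^ (-(2 * Δ))
      rw [hcomm, LinearIsometryEquiv.norm_map]
    · intro m p c hp
      have hp' : ∀ a, 0 < ⟪p a + (p a) 2 • e2, EuclideanSpace.single i (1 : ℝ)⟫_ℝ := by
        intro a
        have h1 : ⟪p a + (p a) 2 • e2, EuclideanSpace.single i (1 : ℝ)⟫_ℝ = (p a + (p a) 2 • e2) i := by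
          simp [EuclideanSpace.inner_single_right]
        have h2 : ⟪p a, EuclideanSpace.single i (1 : ℝ)⟫_ℝ = p a i := by
          simp [EuclideanSpace.inner_single_right]
        have h3 := hp a
        rw [h2] at h3
        rw [h1, hA]
        split_ifs with hi
        · subst hi; linarith
        · exact h3
      have key := riesz_isMirrorRPKernel_single hΔ i m (fun a => p a + (p a) 2 • e2) c hp'
      refine le_of_le_of_eq key (Finset.sum_congr rfl fun a _ => Finset.sum_congr rfl fun b _ => ?_)
      show c a * c b * ‖(p a + (p a) 2 • e2) - (ℝ ∙ EuclideanSpace.single i (1 : ℝ))ᗮ.reflection (p b + (p b) 2 • e2)‖ ^ (-(2 * Δ)) =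
        c a * c b * ‖(p a - (ℝ ∙ EuclideanSpace.single i (1 : ℝ))ᗮ.reflection (p b)) +
          (p a - (ℝ ∙ EuclideanSpace.single i (1 : ℝ))ᗮ.reflection (p b)) 2 • e2‖ ^ (-(2 * Δ))
      congr 2
      rw [← hcomm, PiLp.sub_apply, sub_smul]
      abel
  · -- anisotropy: K e₀ = 1, K e₂ = 4^(-Δ)
    show ‖(EuclideanSpace.single 0 1 : EuclideanSpace ℝ (Fin 3)) + (EuclideanSpace.single 0 1 : EuclideanSpace ℝ (Fin 3)) 2 • e2‖ ^ (-(2 * Δ)) ≠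
      ‖(EuclideanSpace.single 2 1 : EuclideanSpace ℝ (Fin 3)) + (EuclideanSpace.single 2 1 : EuclideanSpace ℝ (Fin 3)) 2 • e2‖ ^ (-(2 * Δ))
    have h0 : (EuclideanSpace.single 0 1 : EuclideanSpace ℝ (Fin 3)) + (EuclideanSpace.single 0 1 : EuclideanSpace ℝ (Fin 3)) 2 • e2 =
        EuclideanSpace.single 0 1 := by simp [he2]
    have h2 : (EuclideanSpace.single 2 1 : EuclideanSpace ℝ (Fin 3)) + (EuclideanSpace.single 2 1 : EuclideanSpace ℝ (Fin 3)) 2 • e2 =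
        (2 : ℝ) • EuclideanSpace.single 2 1 := by
      rw [he2]; simp [two_smul]
    rw [h0, h2, norm_smul, PiLp.norm_single, PiLp.norm_single]
    simp only [norm_one, mul_one, Real.norm_ofNat, Real.one_rpow]
    have hΔ0 : 0 < 2 * Δ := by linarith
    have : (2 : ℝ) ^ (-(2 * Δ)) < 1 := Real.rpow_lt_one_of_one_lt_of_neg (by norm_num) (by linarith)
    exact ne_of_gt this

/-- **The diagonal mirrors are load-bearing in `HRP2Rigidity` / `nineMirrorRigidityBelowFour`.**  For every
`Δ ≥ 1/2` (in particular on the whole Ising window `[1/2, 1]`) the rigidity statement with the six diagonal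
mirrors dropped — continuity, positivity, homogeneity of degree `-2Δ`, invariance and reflection positivity for
the THREE COORDINATE mirrors only — is false: the anisotropic kernel `‖x + x₂ e₂‖^(-2Δ)` satisfies all of it and is
not `O(3)`-invariant. -/
theorem nineMirrorRigidity_false_with_coordinate_mirrors_only {Δ : ℝ} (hΔ : 1 / 2 ≤ Δ) :
    ¬ (∀ K : EuclideanSpace ℝ (Fin 3) → ℝ, ContinuousOn K {0}ᶜ → (∀ x, x ≠ 0 → 0 < K x) →
        (∀ c : ℝ, 0 < c → ∀ x, K (c • x) = c ^ (-(2 * Δ)) * K x) →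
        (∀ i : Fin 3, (∀ x, K ((ℝ ∙ EuclideanSpace.single i (1 : ℝ))ᗮ.reflection x) = K x) ∧
          IsMirrorRPKernel (EuclideanSpace.single i (1 : ℝ)) K) →
        ∀ (R : EuclideanSpace ℝ (Fin 3) ≃ₗᵢ[ℝ] EuclideanSpace ℝ (Fin 3)) (x : EuclideanSpace ℝ (Fin 3)),
          K (R x) = K x) := by
  intro h
  obtain ⟨hc, hpos, hhom, hmir, hne⟩ := anisotropic_coordinateRP_witness hΔ
  -- the isometry swapping `e₀` and `e₂`
  set R : EuclideanSpace ℝ (Fin 3) ≃ₗᵢ[ℝ] EuclideanSpace ℝ (Fin 3) :=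
    LinearIsometryEquiv.piLpCongrLeft 2 ℝ ℝ (Equiv.swap 0 2) with hR
  have hR0 : R (EuclideanSpace.single 0 (1 : ℝ)) = EuclideanSpace.single 2 1 := by
    rw [hR, LinearIsometryEquiv.piLpCongrLeft_single, Equiv.swap_apply_left]
  have := h _ hc hpos hhom hmir R (EuclideanSpace.single 0 1)
  rw [hR0] at this
  exact hne this.symm

end Summit.CriticalPhenomena.Ising3DConformalLimit.Theorems.HRP2Rigidity.Negative

end
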